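import Summits.QuantumFields.YangMills.Theorems.UnitScaleTiltProp7GramInverseFarTail
import Summits.QuantumFields.YangMills.Theorems.UnitScaleTiltProp7ComplementaryProjectorBlockDecay
import Summits.QuantumFields.YangMills.Theorems.UnitScaleTiltProp7NestedMeanPoincare
import HarnessLib

/-!
# Route `UnitScaleTilt`, crux K1 «MinimiserStabilityRegPr» (stmt-QuantumFields-19200), EX row `hGF[Lift]` (curved member) — **LOD LINE, PEN (L5″) (RN-far) FILE B (MEMBER GEOMETRY):
# THE FAR TAIL OF THE GRAM-INVERSE COORDINATES ON THE COARSE TORUS** — the `htail` binder of ✓`Prop7GramDifferenceNearFarSplit.gramDifference_row_of_near_far` (routeR-w3 g12's 2r-door)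
# ∕ ✓`Prop7GramDifferenceRowSum.hRN_of_near_far` AT THE MEMBER'S INDEX TYPES, in hypothesis form over two landed rows:
# * `hN` — the decay of the (flat) coarse Gram inverse in the spike basis, `‖M′⁻¹ i i′‖ ≤ C_N·e^{−μ′·tdist(σ i.1, σ i′.1)}` (✓`Prop7CoarseGramInverseDecay.norm_gram_inv_spike_le_exp_neg_tdist`, B2c,
#   read at the flat system; `σ = siteShift (sites_eq F n K h)`);
# * `hcol` — the localisation of a massive spike column against a block-supported field, `‖⟪G_W(T_W(b i)), toL2S u⟫‖ ≤ A·‖toL2S u‖·e^{−μ·tdist(z, σ i.1)}` for `u ⊂ B(z)`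
#   (✓`Prop7ComplementaryProjectorBlockDecay.norm_inner_spike_column_le`, B4 §2, `A = 8C_P²C_T e^{3μ}`);
# for a source `u` supported in the blocks of a finite block set `S` (the enlarged cube of the (L6) knit; `f = toL2S u`) and any finite index set `N` containing every spike index
# within `tdist < r` of `S`:
# **`√Σ_i‖(if i ∈ N then 0 else (M′⁻¹ b_f)_i)‖² ≤ C_N·A·V·√(V′V″)·e^{−μ′r∕2}·‖toL2S u‖`**, `(b_f)_i = ⟪G_W(T_W(b i)), toL2S u⟫`, with the K-free coarse volumes
# `V = 4(2(1 + 1∕(μ−μ′)))³`, `V′ = (2(1 + 1∕(μ′∕2)))³`, `V″ = 4(2(1 + 1∕(μ′∕2)))³` (✓`Prop7BlockDistanceWeights.sum_exp_neg_mul_tdist_coarse_le`, ✓B4 `sum_exp_neg_mul_dc_spike_le`).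
# The summation itself is FILE A ✓`Prop7GramInverseFarTail.sqrt_sum_normSq_far_coords_le`; this file supplies its member inputs: the block decomposition `u = Σ_{z∈S} u_z` with
# `Σ_{z∈S}‖toL2S u_z‖² = ‖toL2S u‖²` (✓`Prop7NestedMeanPoincare.normSq_toL2S_eq`), the column row summed over the decomposition, the triangle inequality and the three volumes.

Cell `ym3-torus` (HUMAN RULING D-0037, YM ladder rung R3 — NOT d = 4, NOT infinite volume, NOT a mass gap, NOT Clay).  Width seat `ym-routeR-w2` gen 13 (routeR-w3 g12
2026-08-30 01:54:13Z «(RN-far) … routeR-w2 ✓p753397 × ✓p753767 × ✓p752577∕✓p754074 volumes»).  THEOREMS ONLY (0 `def`, 0 `sorry`); `--supports stmt-QuantumFields-19200 --as helper`,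
count-neutral.  HONEST LABEL (★★OWNER RULING №33 (6)): curved γ-row supplier line (LOD localisation), pen (L5″); ℓ² bookkeeping on the coarse torus in hypothesis form (the basis `b`, the
column maps `G_W, T_W` and the matrix `M′⁻¹` are letters; their rows are discharged by name by the (L5″)∕(L6) assembler) — nothing of (RN) at the member beyond this tail, (3.49), Thm 3.1∕3.3,
`h349`, `hGF`, EX ∕ 19200 is proved here; the decay length `1∕μ′` is the window's (routeR-w2 g12's quantitative flag of record stands).

WHAT IS PROVED (ns `Summit.QuantumFields.YangMills.Theorems.Prop7GramInverseFarTailMember`).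
* §1 `blockPiece_eq_zero_off_block`, `sum_blockPiece_eq` (`u = Σ_{z∈S} u_z`), `sum_normSq_entries_blockPiece_eq`, ★ `sum_normSq_toL2S_blockPiece_eq` (`Σ_{z∈S}‖toL2S u_z‖² = ‖toL2S u‖²`).
* §2 ★★ `norm_inner_column_blockSet_le` (the column row against an `S`-supported source: `‖⟪G_W(T_W(b i)), toL2S u⟫‖ ≤ Σ_{z∈S} A·e^{−μ·tdist(z, σ i.1)}·‖toL2S u_z‖`).
* §3 `tdist_spike_triangle`, `sum_exp_neg_mul_tdist_spike_le` (`V″`), `sum_exp_neg_mul_tdist_blockSet_le` (`V′`).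
* §4 ★★★ `sqrt_sum_normSq_far_gramInv_coords_le` (the member `htail`).

References: T. Bałaban, CMP **99** (1985) 389–434 [Balaban1985BackgroundPropagators] ((3.21)–(3.26) pp.394–395, (3.49) p.399, (3.105)–(3.106) p.414); CMP **98** (1985) 17–51
[Balaban1985Averaging] ((2) p.17).
-/

set_option autoImplicit false

noncomputable section

open scoped BigOperators Matrix.Norms.L2Operator InnerProductSpace ComplexConjugate Matrix

namespace Summit.QuantumFields.YangMills.Theorems.Prop7GramInverseFarTailMember

open Literature.MathematicalPhysics.QuantumFieldTheory.Balaban1983to89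
open Finset
open T4Continuum BlockAveraging
open B5Eq118OneStroke (iterBlockOf iterBlock mem_iterBlock card_iterBlock)
open B9Eq311L2Pairing (WL2)
open B11Eq103H1Complex (SiteL2K BondL2K)
open Literature.MathematicalPhysics.QuantumFieldTheory.Balaban1983to89.T3ContinuumYM3Torus
open T3PrintedRegularOrbits (sites_eq)
open T3LevelShift (siteShift)
open Summit.QuantumFields.YangMills.Theorems.Prop7SectET3Transport (periodsT3)
open Summit.QuantumFields.YangMills.Theorems.Prop7SectET3HilbertLetters (W₂ toL2S)
open Summit.QuantumFields.YangMills.Theorems.Prop7BlockDistanceWeights (sum_exp_neg_mul_tdist_coarse_le tdist_coarse_comm tdist_coarse_triangle)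
open Summit.QuantumFields.YangMills.Theorems.Prop7ComplementaryProjectorBlockDecay (sum_exp_neg_mul_dc_spike_le)
open Summit.QuantumFields.YangMills.Theorems.Prop7NestedMeanPoincare (normSq_toL2S_eq)
open Summit.QuantumFields.YangMills.Theorems.Prop7GramInverseFarTail (sqrt_sum_normSq_far_coords_le)

variable (F : T3Family) {n K : ℕ} (h : n ≤ K) {c₀ c₁ : ℝ} [Fact (0 < c₀)] [Fact (0 < c₁)]

/-! ## §1 The block decomposition of an `S`-supported source -/

omit [Fact (0 < c₀)] [Fact (0 < c₁)] in
/-- The block piece `u_z := u·1_{B(z)}` vanishes off `B(z)`. [folklore] -/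
theorem blockPiece_eq_zero_off_block (z : Site (F.P K) (K - n)) (u : Site (F.P K) 0 → Matrix (Fin 2) (Fin 2) ℂ)
    (x : Site (F.P K) 0) (hx : iterBlockOf (K - n) x ≠ z) : (if iterBlockOf (K - n) x = z then u x else (0 : Matrix (Fin 2) (Fin 2) ℂ)) = 0 :=
  if_neg hx

omit [Fact (0 < c₀)] [Fact (0 < c₁)] in
/-- **`u = Σ_{z∈S} u_z`** for `u` supported in the blocks of `S`. [cite: Balaban1985Averaging, (2) p.17] -/
theorem sum_blockPiece_eq (S : Finset (Site (F.P K) (K - n))) (u : Site (F.P K) 0 → Matrix (Fin 2) (Fin 2) ℂ)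
    (hu : ∀ x, iterBlockOf (K - n) x ∉ S → u x = 0) :
    ∑ z ∈ S, (fun x => if iterBlockOf (K - n) x = z then u x else 0) = u := by
  funext x
  rw [Finset.sum_apply, Finset.sum_ite_eq]
  by_cases hx : iterBlockOf (K - n) x ∈ S
  · rw [if_pos hx]
  · rw [if_neg hx, hu x hx]

omit [Fact (0 < c₀)] [Fact (0 < c₁)] in
/-- Entrywise: at a site `x`, the block pieces over `z ∈ S` carry the entries of `u x` exactly once (`u` supported in the blocks of `S`). [folklore] -/
theorem sum_normSq_entries_blockPiece_eq (S : Finset (Site (F.P K) (K - n))) (u : Site (F.P K) 0 → Matrix (Fin 2) (Fin 2) ℂ)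
    (hu : ∀ x, iterBlockOf (K - n) x ∉ S → u x = 0) (x : Site (F.P K) 0) :
    ∑ z ∈ S, ∑ j : Fin 2, ∑ k : Fin 2, ‖(if iterBlockOf (K - n) x = z then u x else (0 : Matrix (Fin 2) (Fin 2) ℂ)) j k‖ ^ 2 = ∑ j : Fin 2, ∑ k : Fin 2, ‖u x j k‖ ^ 2 := by
  by_cases hx : iterBlockOf (K - n) x ∈ S
  · rw [Finset.sum_eq_single_of_mem (iterBlockOf (K - n) x) hx]
    · rw [if_pos rfl]
    · intro _ _ hzx
      rw [if_neg (Ne.symm hzx)]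
      simp
  · rw [hu x hx]
    simp

/-- ★ **THE BLOCK PIECES ARE `ℓ²`-ORTHOGONAL**: `Σ_{z∈S} ‖toL2S u_z‖² = ‖toL2S u‖²` for `u` supported in the blocks of `S` (✓`normSq_toL2S_eq`: `‖toL2S l‖² = c₀ Σ_x Σ_{jk} ‖l x j k‖²`).
[cite: Balaban1985BackgroundPropagators, (3.11) p.392; Balaban1985Averaging, (2) p.17] -/
theorem sum_normSq_toL2S_blockPiece_eq (S : Finset (Site (F.P K) (K - n))) (u : Site (F.P K) 0 → Matrix (Fin 2) (Fin 2) ℂ)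
    (hu : ∀ x, iterBlockOf (K - n) x ∉ S → u x = 0) :
    ∑ z ∈ S, ‖toL2S F K c₀ (fun x => if iterBlockOf (K - n) x = z then u x else 0)‖ ^ 2 = ‖toL2S F K c₀ u‖ ^ 2 := by
  simp_rw [normSq_toL2S_eq]
  rw [← Finset.mul_sum, Finset.sum_comm]
  congr 1
  exact Finset.sum_congr rfl fun x _ => sum_normSq_entries_blockPiece_eq F S u hu x

/-! ## §2 The column row against an `S`-supported source -/

omit [Fact (0 < c₁)] in
/-- ★★ **THE COLUMN ROW SUMMED OVER THE BLOCK DECOMPOSITION**: if every spike column pairs with every block-supported field as `‖⟪G_W(T_W(b i)), toL2S w⟫‖ ≤ A·‖toL2S w‖·e^{−μ·tdist(z, σ i.1)}`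
(`w ⊂ B(z)`; B4 §2 ✓`norm_inner_spike_column_le`), then for `u` supported in the blocks of `S`:
`‖⟪G_W(T_W(b i)), toL2S u⟫‖ ≤ Σ_{z∈S} A·e^{−μ·tdist(z, σ i.1)}·‖toL2S u_z‖`. [cite: Balaban1985BackgroundPropagators, (3.21)–(3.25) p.394, (3.49) p.399] -/
theorem norm_inner_column_blockSet_le (b : Site (F.P n) 0 × (Fin 2 × Fin 2) → SiteL2K ℂ 3 (periodsT3 F n) c₁ W₂)
    (GW : SiteL2K ℂ 3 (periodsT3 F K) c₀ W₂ →ₗ[ℂ] SiteL2K ℂ 3 (periodsT3 F K) c₀ W₂) (TW : SiteL2K ℂ 3 (periodsT3 F n) c₁ W₂ →ₗ[ℂ] SiteL2K ℂ 3 (periodsT3 F K) c₀ W₂)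
    {A μ : ℝ}
    (hcol : ∀ (i : Site (F.P n) 0 × (Fin 2 × Fin 2)) (z : Site (F.P K) (K - n)) (w : Site (F.P K) 0 → Matrix (Fin 2) (Fin 2) ℂ),
      (∀ x, iterBlockOf (K - n) x ≠ z → w x = 0) →
        ‖⟪GW (TW (b i)), toL2S F K c₀ w⟫_ℂ‖ ≤ A * ‖toL2S F K c₀ w‖ * Real.exp (-(μ * (Site.tdist (P := F.P K) z (siteShift (sites_eq F n K h) i.1) : ℝ))))
    (S : Finset (Site (F.P K) (K - n))) (u : Site (F.P K) 0 → Matrix (Fin 2) (Fin 2) ℂ) (hu : ∀ x, iterBlockOf (K - n) x ∉ S → u x = 0)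
    (i : Site (F.P n) 0 × (Fin 2 × Fin 2)) :
    ‖⟪GW (TW (b i)), toL2S F K c₀ u⟫_ℂ‖
      ≤ ∑ z ∈ S, A * Real.exp (-(μ * (Site.tdist (P := F.P K) z (siteShift (sites_eq F n K h) i.1) : ℝ)))
          * ‖toL2S F K c₀ (fun x => if iterBlockOf (K - n) x = z then u x else 0)‖ := by
  have hdec : toL2S F K c₀ u = ∑ z ∈ S, toL2S F K c₀ (fun x => if iterBlockOf (K - n) x = z then u x else 0) := by
    rw [← map_sum, sum_blockPiece_eq F S u hu]
  rw [hdec, inner_sum]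
  refine (norm_sum_le _ _).trans (Finset.sum_le_sum fun z _ => ?_)
  calc ‖⟪GW (TW (b i)), toL2S F K c₀ (fun x => if iterBlockOf (K - n) x = z then u x else 0)⟫_ℂ‖
      ≤ A * ‖toL2S F K c₀ (fun x => if iterBlockOf (K - n) x = z then u x else 0)‖ * Real.exp (-(μ * (Site.tdist (P := F.P K) z (siteShift (sites_eq F n K h) i.1) : ℝ))) :=
        hcol i z _ (fun x hx => blockPiece_eq_zero_off_block F z u x hx)
    _ = _ := by ring

/-! ## §3 The pseudo-distances and the three coarse volumes -/

omit [Fact (0 < c₀)] [Fact (0 < c₁)] in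
/-- **TRIANGLE THROUGH A SPIKE INDEX**: `tdist(z, σ i.1) ≤ tdist(σ i.1, σ i′.1) + tdist(z, σ i′.1)` (✓`tdist_coarse_triangle`, ✓`tdist_coarse_comm`). [folklore] -/
theorem tdist_spike_triangle (i i' : Site (F.P n) 0 × (Fin 2 × Fin 2)) (z : Site (F.P K) (K - n)) :
    (Site.tdist (P := F.P K) z (siteShift (sites_eq F n K h) i.1) : ℝ)
      ≤ (Site.tdist (P := F.P K) (siteShift (sites_eq F n K h) i.1) (siteShift (sites_eq F n K h) i'.1) : ℝ)
          + (Site.tdist (P := F.P K) z (siteShift (sites_eq F n K h) i'.1) : ℝ) := by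
  have h1 := tdist_coarse_triangle F (n := n) (K := K) z (siteShift (sites_eq F n K h) i'.1) (siteShift (sites_eq F n K h) i.1)
  rw [tdist_coarse_comm F (n := n) (K := K) (siteShift (sites_eq F n K h) i'.1) (siteShift (sites_eq F n K h) i.1)] at h1
  linarith

omit [Fact (0 < c₀)] [Fact (0 < c₁)] in
/-- **THE SPIKE VOLUME AT A COARSE CENTRE** (`V`, `V″`): `Σ_i e^{−ν·tdist(z, σ i.1)} ≤ 4·(2(1 + 1∕ν))³` for every coarse `z` (B4 ✓`sum_exp_neg_mul_dc_spike_le` at the index representative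
`(σ⁻¹ z, (0,0))`). [cite: Balaban1985BackgroundPropagators, (3.49) p.399] -/
theorem sum_exp_neg_mul_tdist_spike_le {ν : ℝ} (hν : 0 < ν) (z : Site (F.P K) (K - n)) :
    ∑ i : Site (F.P n) 0 × (Fin 2 × Fin 2), Real.exp (-(ν * (Site.tdist (P := F.P K) z (siteShift (sites_eq F n K h) i.1) : ℝ))) ≤ 4 * (2 * (1 + 1 / ν)) ^ 3 := by
  have hz : siteShift (sites_eq F n K h) ((siteShift (sites_eq F n K h)).symm z) = z := Equiv.apply_symm_apply _ _
  have h1 := sum_exp_neg_mul_dc_spike_le F h hν ((siteShift (sites_eq F n K h)).symm z, ((0 : Fin 2), (0 : Fin 2)))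
  simp only [hz] at h1
  refine le_of_eq_of_le (Finset.sum_congr rfl fun i _ => ?_) h1
  rw [tdist_coarse_comm F (n := n) (K := K) z]

omit [Fact (0 < c₀)] [Fact (0 < c₁)] in
/-- **THE BLOCK-SET VOLUME AT A SPIKE INDEX** (`V′`): `Σ_{z∈S} e^{−ν·tdist(z, σ i.1)} ≤ (2(1 + 1∕ν))³` (B3 ✓`sum_exp_neg_mul_tdist_coarse_le`, summands `≥ 0`).
[cite: Balaban1985BackgroundPropagators, (3.49) p.399] -/
theorem sum_exp_neg_mul_tdist_blockSet_le {ν : ℝ} (hν : 0 < ν) (S : Finset (Site (F.P K) (K - n))) (i : Site (F.P n) 0 × (Fin 2 × Fin 2)) :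
    ∑ z ∈ S, Real.exp (-(ν * (Site.tdist (P := F.P K) z (siteShift (sites_eq F n K h) i.1) : ℝ))) ≤ (2 * (1 + 1 / ν)) ^ 3 :=
  (Finset.sum_le_univ_sum_of_nonneg fun _ => Real.exp_nonneg _).trans (sum_exp_neg_mul_tdist_coarse_le F hν _)

/-! ## §4 The member far tail -/

omit [Fact (0 < c₁)] in
/-- ★★★ **THE FAR TAIL OF THE GRAM-INVERSE COORDINATES AT THE MEMBER** (the `htail` binder of ✓`Prop7GramDifferenceNearFarSplit.gramDifference_row_of_near_far` ∕
✓`Prop7GramDifferenceRowSum.hRN_of_near_far`): for a coarse basis family `b`, column maps `G_W, T_W`, a matrix `M′⁻¹ =: Ninv` over the spike indices with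
`hN : ‖Ninv i i′‖ ≤ C_N·e^{−μ′·tdist(σ i.1, σ i′.1)}` (B2c at the flat system) and the column localisation `hcol` (B4 §2), slopes `0 < μ′ < μ`, a source `u` supported in the blocks of `S`,
and any finite `N` with `∀ i ∉ N, ∀ z ∈ S, r ≤ tdist(z, σ i.1)`:
**`√Σ_i‖(if i ∈ N then 0 else (Ninv *ᵥ b_f)_i)‖² ≤ (C_N·A·(4(2(1+1∕(μ−μ′)))³)·√((2(1+1∕(μ′∕2)))³·(4(2(1+1∕(μ′∕2)))³))·e^{−μ′r∕2})·‖toL2S u‖`**, `(b_f)_i = ⟪G_W(T_W(b i)), toL2S u⟫`.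
[cite: Balaban1985BackgroundPropagators, (3.21)–(3.26) pp.394–395, (3.49) p.399, (3.105)–(3.106) p.414] -/
theorem sqrt_sum_normSq_far_gramInv_coords_le (b : Site (F.P n) 0 × (Fin 2 × Fin 2) → SiteL2K ℂ 3 (periodsT3 F n) c₁ W₂)
    (GW : SiteL2K ℂ 3 (periodsT3 F K) c₀ W₂ →ₗ[ℂ] SiteL2K ℂ 3 (periodsT3 F K) c₀ W₂) (TW : SiteL2K ℂ 3 (periodsT3 F n) c₁ W₂ →ₗ[ℂ] SiteL2K ℂ 3 (periodsT3 F K) c₀ W₂)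
    (Ninv : Matrix (Site (F.P n) 0 × (Fin 2 × Fin 2)) (Site (F.P n) 0 × (Fin 2 × Fin 2)) ℂ)
    {CN A μ μ' r : ℝ} (hCN : 0 ≤ CN) (hA : 0 ≤ A) (hμ' : 0 < μ') (hμμ' : μ' < μ)
    (hN : ∀ i i', ‖Ninv i i'‖ ≤ CN * Real.exp (-(μ' * (Site.tdist (P := F.P K) (siteShift (sites_eq F n K h) i.1) (siteShift (sites_eq F n K h) i'.1) : ℝ))))
    (hcol : ∀ (i : Site (F.P n) 0 × (Fin 2 × Fin 2)) (z : Site (F.P K) (K - n)) (w : Site (F.P K) 0 → Matrix (Fin 2) (Fin 2) ℂ),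
      (∀ x, iterBlockOf (K - n) x ≠ z → w x = 0) →
        ‖⟪GW (TW (b i)), toL2S F K c₀ w⟫_ℂ‖ ≤ A * ‖toL2S F K c₀ w‖ * Real.exp (-(μ * (Site.tdist (P := F.P K) z (siteShift (sites_eq F n K h) i.1) : ℝ))))
    (S : Finset (Site (F.P K) (K - n))) (u : Site (F.P K) 0 → Matrix (Fin 2) (Fin 2) ℂ) (hu : ∀ x, iterBlockOf (K - n) x ∉ S → u x = 0)
    (N : Finset (Site (F.P n) 0 × (Fin 2 × Fin 2)))
    (hfar : ∀ i, i ∉ N → ∀ z ∈ S, r ≤ (Site.tdist (P := F.P K) z (siteShift (sites_eq F n K h) i.1) : ℝ)) :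
    Real.sqrt (∑ i, ‖(if i ∈ N then (0 : ℂ) else (Ninv *ᵥ fun i' => ⟪GW (TW (b i')), toL2S F K c₀ u⟫_ℂ) i)‖ ^ 2)
      ≤ (CN * A * (4 * (2 * (1 + 1 / (μ - μ'))) ^ 3) * Real.sqrt ((2 * (1 + 1 / (μ' / 2))) ^ 3 * (4 * (2 * (1 + 1 / (μ' / 2))) ^ 3))
          * Real.exp (-(μ' * r / 2))) * ‖toL2S F K c₀ u‖ := by
  have hμ2 : 0 < μ' / 2 := by positivity
  have hmm : 0 < μ - μ' := sub_pos.mpr hμμ'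
  have hmain := sqrt_sum_normSq_far_coords_le
    (fun (i : Site (F.P n) 0 × (Fin 2 × Fin 2)) (z : Site (F.P K) (K - n)) => (Site.tdist (P := F.P K) z (siteShift (sites_eq F n K h) i.1) : ℝ))
    (fun (i i' : Site (F.P n) 0 × (Fin 2 × Fin 2)) => (Site.tdist (P := F.P K) (siteShift (sites_eq F n K h) i.1) (siteShift (sites_eq F n K h) i'.1) : ℝ))
    (fun i i' z => tdist_spike_triangle F h i i' z) Ninv (fun i' => ⟪GW (TW (b i')), toL2S F K c₀ u⟫_ℂ) S
    (fun z => ‖toL2S F K c₀ (fun x => if iterBlockOf (K - n) x = z then u x else 0)‖) (fun z => norm_nonneg _)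
    hCN hA hμ'.le (by positivity : (0 : ℝ) ≤ 4 * (2 * (1 + 1 / (μ - μ'))) ^ 3) (by positivity : (0 : ℝ) ≤ (2 * (1 + 1 / (μ' / 2))) ^ 3)
    (by positivity : (0 : ℝ) ≤ 4 * (2 * (1 + 1 / (μ' / 2))) ^ 3) hN
    (norm_inner_column_blockSet_le F h b GW TW hcol S u hu)
    (fun z => sum_exp_neg_mul_tdist_spike_le F h hmm z) N hfar
    (fun i => sum_exp_neg_mul_tdist_blockSet_le F h hμ2 S i) (fun z => sum_exp_neg_mul_tdist_spike_le F h hμ2 z)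
  rwa [sum_normSq_toL2S_blockPiece_eq F S u hu, Real.sqrt_sq (norm_nonneg _)] at hmain

end Summit.QuantumFields.YangMills.Theorems.Prop7GramInverseFarTailMember

end
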